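import Summits.NavierStokesRegularity.FluidComputer.GateBudgetNecessity
import Summits.NavierStokesRegularity.FluidComputer.GateBudgetPinnedPhase
import HarnessLib

/-!
# What no tuning can beat, part 17: THE DUD LATTICE — the member `σ_knob M = 1/k` leaves the
# pulse in pure input phase and is a dud, and EVERY dyadic knob window with `σ_knob M ≤ 2`
# contains such a member: robust firing across a factor `2` in the knob needs `σ_knob M > 2`

Cell `pub-fluidc`, blueprint seat bp1 (gen 29); same namespace and conventions as parts 1–16
(`GateBudget*.lean`); imports part 12 (`GateBudgetNecessity`: the end-game freeze
`knob_carrier_freeze_selftimed`) and part 16 (`GateBudgetPinnedPhase`: swing from levels, phase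
bracket, pinned exit, lattice phase). Modes `0 = a` input, `1 = b` clock, `2 = c` catalyst
(`u = c/ρ²`), `3 = d` transfer, `4 = ã` output; `σ_knob = ρ²/ε`; notation of part 16
(`Φ₀`, `Θ`, `η`, `q = ε²/(Mϱ²)`, `D₀ = ρ²e^{-M}(T-s₀)/ϱ`, `L_t = ε + ρ²e^{-M} + Kã(t)`).
HONEST FRAMING (verbatim): low prior, high value-of-information experiment on Tao's machine
paradigm; NOT a claim that NS blows up. Nothing is proved about the Navier–Stokes equations.

## What this part records (SPEC-INPUT-bp1 §W item (1) = S13″c (iii), dud half, and the window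
## form of the phase-selection necessity S13″c)

* §52 THE DUD ON ONE TRAJECTORY. `knob_output_cap`: along any member (`0 < ρ² ≤ ε ≤ 1`, `0 < M`,
  `0 ≤ K`) with the clock dead at `T ≥ 0` (`b(T) ≤ -β < 0`), for EVERY `t ∈ [0, T + β/(2ε)]`:
  `ã(t)² ≤ 1 - a(T)² + A`, `A := 4ε(u(T) + ε)/(Mβ) + 4e^{-M}/M` (part 12's freeze after `T`,
  monotone output before `T`, energy; NO band factor `e^{-2(2ε+K)(T-s₀)}`): THE OUTPUT IS CAPPED
  BY THE INPUT MODE LEFT AT CLOCK DEATH. `knob_lattice_dud`: on the lattice member `ε = kMρ²`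
  entered ARMED at `s₀` with pre-entry dose `|Φ₀| ≤ φ₀`, window `[s₀,T]` as in part 16, DEAD at
  `T` with `c(T) ≤ λ₀ρ²`: with `ψ ≥ k(η + (πq + D₀)/(1-q)) + φ₀`, `D ≥ 4L_{s₀}s₀ + 2L_T(T-s₀)`
  and `1 - ψ²/2 - D ≥ 0`, the deficit obeys `1 - ã(t)² ≥ (1 - ψ²/2 - D)² - A(λ₀)` at EVERY time
  `t ≤ T + β/(2ε)` — THE LATTICE MEMBER IS A DUD (it exits with `|a(T)| ≥ 1 - ψ²/2 - D`).
* §53 THE WINDOW FORM. `exists_lattice_knob`: every dyadic knob window `ρ² ∈ [ρhi²/2, ρhi²]`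
  with `Mρhi² ≤ 2ε` (`σ_hi M ≤ 2`) contains a lattice knob `ρ² = ε/(kM)`, `1 ≤ k ≤ 2ε/(Mρhi²)`
  (`k = ⌈ε/(Mρhi²)⌉`). `knob_window_dud`: for ANY family `ρ ↦ X ρ` of exact trajectories from
  (5.6) with catalyst primitives `C ρ` whose level / window / dose / output hypotheses hold
  UNIFORMLY on such a window at common times `0 ≤ s₀ ≤ T` (armed `b₁, γ₁`, `|Φ₀| ≤ φ₀`,
  `ã(s₀) ≤ θ₀`; catalyst alive and clock radius `≥ ϱ` on `[s₀,T]`, `Mϱ² > ε²`; dead `β`,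
  `u(T) ≤ λ₀`, `ã(T) ≤ θ_T`), SOME MEMBER OF THE WINDOW IS A DUD with the explicit deficit
  `(1 - ψ²/2 - D)² - A(λ₀)`, `ψ = (2ε/(Mρhi²))ζ_hi + φ₀`, `D = 4(ε + ρhi²e^{-M} + Kθ₀)s₀ +
  2(ε + ρhi²e^{-M} + Kθ_T)(T-s₀)` (all constants read at `ρhi`); `knob_window_not_robust`: hence
  if EVERY member of the window fires to deficit `δ` by time `T + β/(2ε)` then
  `δ ≥ (1 - ψ²/2 - D)² - A(λ₀)`.

READING (the phase-selection half of S13″ as a necessity statement modulo LEVELS): robust firing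
to a small deficit across a factor `2` in the seed knob is impossible whenever `σ_knob M ≤ 2` —
by PHASE ALONE, independently of part 12's amplitude inequality: below `σ_knob M ≈ 2` the exit
phase `Θ ≈ π/(σ_knob M)` (part 16) sweeps through a multiple of `π` inside every dyadic window,
and the member sitting there transfers (almost) nothing. Compared with part 15 (`knob_lock_or_dud`,
`knob_dud_of_opposite_phases`): no anchors, no continuity in `ρ` (part 13), no intermediate value
theorem, no exact zero of `d(T;·)`; the dud is NAMED (`σ_knob M = 1/k`, exactly where the toy's
sign of `d(T;·)` flips, part 15 TOY) and its deficit carries no crude band factor, so the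
statement keeps content as long as the drift `D` is small (`K·ã(T)·(T - s₀) ≪ 1`), not
`K(T - s₀) ≪ 1`.

HONEST LIMITS. LEVELS at the common times `s₀`, `T`, the window radius `ϱ`, the pre-entry dose
bound `φ₀` and the output levels `θ₀, θ_T` are HYPOTHESES, uniform on the window in §53 (no
hitting times are constructed; `Φ₀` from catalyst levels is a successor item); "dud" means:
deficit `≥ (1 - ψ²/2 - D)² - A` at every time `≤ T + β/(2ε)` — a later second pulse is not
excluded here (part 10's no-return law needs its own window); only the lattice member is
classified (members near `σ_knob M = 2/(2k+1)` exit in quadrature and are the firing candidates —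
not treated); nothing about the cascade or Navier–Stokes; `0` named facts, `0` sorry.
[cite: Tao2016AveragedNS, §5.5 Theorem 5.3, (5.5), (5.6), (b-eq), (energy-con)]
-/

noncomputable section

namespace Summit.NavierStokesRegularity.FluidComputer.GateBudget

open Real Set Filter Topology
open Literature.Analysis.FluidPDE.Tao2016AveragedNS

variable {K M ε ρ : ℝ} {X : ℝ → Fin 5 → ℝ} {C : ℝ → ℝ}

/-! ## §52 The dud on one trajectory: the output is capped by the input mode at clock death -/

/-- **OUTPUT CAP AFTER CLOCK DEATH.** Along `rotorCircuit K M ε ρ` (`0 < ρ² ≤ ε ≤ 1`, `0 < M`,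
`0 ≤ K`) with the clock dead at `T ≥ 0` (`b(T) ≤ -β < 0`): for EVERY `t ∈ [0, T + β/(2ε)]`,
`ã(t)² ≤ 1 - a(T)² + A`, `A = 4ε(u(T) + ε)/(Mβ) + 4e^{-M}/M` — part 12's freeze after `T`, the
monotone output before `T`, and the energy identity; no band factor.
[cite: Tao2016AveragedNS, §5.5 Theorem 5.3, (energy-con)] -/
theorem knob_output_cap (hX : ∀ t, HasDerivAt X (RotorKnob.rotorCircuit K M ε ρ (X t)) t)
    (h0 : X 0 = delayInit) (hε : 0 < ε) (hε1 : ε ≤ 1) (hρ : 0 < ρ) (hρε : ρ ^ 2 ≤ ε)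
    (hM : 0 < M) (hK : 0 ≤ K) {T β : ℝ} (hT : 0 ≤ T) (hβ : 0 < β) (hbT : X T 1 ≤ -β) {t : ℝ}
    (ht : t ∈ Icc 0 (T + β / (2 * ε))) :
    X t 4 ^ 2 ≤ 1 - X T 0 ^ 2 + (4 * ε * (X T 2 / ρ ^ 2 + ε) / (M * β) + 4 * exp (-M) / M) := by
  have hsq : ∀ s, X s 4 ^ 2 ≤ 1 - X s 0 ^ 2 := fun s => by
    have := RotorKnob.traj_sum_sq_eq_one hX h0 s
    nlinarith [sq_nonneg (X s 1), sq_nonneg (X s 2), sq_nonneg (X s 3)]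
  have hu0 : 0 ≤ X T 2 / ρ ^ 2 := div_nonneg (RotorKnob.c_nonneg hX h0 hT) (by positivity)
  have hA : 0 ≤ 4 * ε * (X T 2 / ρ ^ 2 + ε) / (M * β) + 4 * exp (-M) / M :=
    add_nonneg (div_nonneg (mul_nonneg (by positivity) (by linarith)) (by positivity))
      (by positivity)
  rcases le_total t T with htT | hTt
  · have hmono : X t 4 ≤ X T 4 := RotorKnob.rotorCircuit_output_monotone hK hX htT
    have h0t : 0 ≤ X t 4 := RotorKnob.e_nonneg hX h0 hK ht.1
    have hT4 : X t 4 ^ 2 ≤ X T 4 ^ 2 := by nlinarith [mul_self_le_mul_self h0t hmono]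
    linarith [hsq T]
  · have hfr := knob_carrier_freeze_selftimed hX h0 hε hε1 hρ hρε hM hT hβ hbT ⟨hTt, ht.2⟩
    linarith [hsq t]

/-- **THE LATTICE DUD.** Along the lattice member `ε = kMρ²` (`0 < ρ² ≤ ε ≤ 1`, `0 < M`, `0 ≤ K`),
entered at `s₀ ≥ 0` with the clock ARMED (`b(s₀) ≥ b₁ > 0`, `c(s₀) ≤ γ₁`) and pre-entry dose
`|Φ₀| ≤ φ₀`, window `[s₀,T]` as in `knob_phase_bracket`, clock DEAD at `T` (`b(T) ≤ -β < 0`,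
`c(T) ≤ λ₀ρ²`), and with `ψ ≥ k(η + (πq + D₀)/(1-q)) + φ₀` (`η = arctan(γ₁/b₁) + arctan(λ₀ρ²/β)`),
`D ≥ 4L_{s₀}s₀ + 2L_T(T - s₀)`, `1 - ψ²/2 - D ≥ 0`: for EVERY `t ∈ [0, T + β/(2ε)]`,
`ã(t)² ≤ 1 - (1 - ψ²/2 - D)² + 4ε(λ₀ + ε)/(Mβ) + 4e^{-M}/M` — THE MEMBER IS A DUD.
[cite: Tao2016AveragedNS, §5.5 Theorem 5.3, (5.5), (5.6), (b-eq), (energy-con)] -/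
theorem knob_lattice_dud (hX : ∀ t, HasDerivAt X (RotorKnob.rotorCircuit K M ε ρ (X t)) t)
    (h0 : X 0 = delayInit) (hε : 0 < ε) (hε1 : ε ≤ 1) (hρ : 0 < ρ) (hρε : ρ ^ 2 ≤ ε)
    (hM : 0 < M) (hK : 0 ≤ K) (hC : ∀ t, HasDerivAt C (X t 2) t) (k : ℕ)
    (hk : ε = k * M * ρ ^ 2) {s₀ T ϱ β b₁ γ₁ lam₀ φ₀ ψ D : ℝ} (hs₀ : 0 ≤ s₀) (hsT : s₀ ≤ T)
    (hϱ : 0 < ϱ) (hq : ε ^ 2 < M * ϱ ^ 2) (hc : ∀ t ∈ Icc s₀ T, 0 < X t 2)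
    (hr : ∀ t ∈ Icc s₀ T, ϱ ^ 2 ≤ X t 1 ^ 2 + X t 2 ^ 2) (hb₁ : 0 < b₁) (hbs : b₁ ≤ X s₀ 1)
    (hcγ : X s₀ 2 ≤ γ₁) (hβ : 0 < β) (hbT : X T 1 ≤ -β) (hcl : X T 2 ≤ lam₀ * ρ ^ 2)
    (hΦ₀ : |(C s₀ - C 0) / ρ ^ 2| ≤ φ₀)
    (hψ : k * (arctan (γ₁ / b₁) + arctan (lam₀ * ρ ^ 2 / β) + (π * (ε ^ 2 / (M * ϱ ^ 2))
      + ρ ^ 2 * exp (-M) * (T - s₀) / ϱ) / (1 - ε ^ 2 / (M * ϱ ^ 2))) + φ₀ ≤ ψ)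
    (hD : 4 * ((ε + ρ ^ 2 * exp (-M) + K * X s₀ 4) * s₀)
      + 2 * ((ε + ρ ^ 2 * exp (-M) + K * X T 4) * (T - s₀)) ≤ D) (hm : 0 ≤ 1 - ψ ^ 2 / 2 - D)
    {t : ℝ} (ht : t ∈ Icc 0 (T + β / (2 * ε))) :
    X t 4 ^ 2 ≤ 1 - (1 - ψ ^ 2 / 2 - D) ^ 2
      + (4 * ε * (lam₀ + ε) / (M * β) + 4 * exp (-M) / M) := by
  have hη := knob_swing_lower hb₁ hbs (hc s₀ ⟨le_rfl, hsT⟩) hcγ hβ hbT (hc T ⟨hsT, le_rfl⟩) hcl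
  have hph := knob_lattice_phase hX h0 hε hρ hM hC k hk hsT hϱ hq hc hr hη hΦ₀
  obtain ⟨-, ha⟩ := knob_pinned_exit hX h0 hC hε.le hK hs₀ hsT k (hph.trans hψ)
  have hcap := knob_output_cap hX h0 hε hε1 hρ hρε hM hK (hs₀.trans hsT) hβ hbT ht
  -- `|a(T)| ≥ 1 - ψ²/2 - D ≥ 0`, so `a(T)² ≥ (1 - ψ²/2 - D)²`
  have hpin : 1 - ψ ^ 2 / 2 - D ≤ |X T 0| := le_trans (by linarith) ha
  have hsqa : (1 - ψ ^ 2 / 2 - D) ^ 2 ≤ X T 0 ^ 2 := by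
    rw [← sq_abs (X T 0)]
    exact pow_le_pow_left₀ hm hpin 2
  -- the action is monotone in `u(T) ≤ λ₀`
  have hu : X T 2 / ρ ^ 2 ≤ lam₀ := by rwa [div_le_iff₀ (by positivity)]
  have hMβ : 0 < M * β := by positivity
  have hA : 4 * ε * (X T 2 / ρ ^ 2 + ε) / (M * β) ≤ 4 * ε * (lam₀ + ε) / (M * β) :=
    div_le_div_of_nonneg_right (mul_le_mul_of_nonneg_left (by linarith) (by positivity)) hMβ.le
  linarith

/-! ## §53 The window form: every dyadic knob window below `σ_knob M = 2` contains a dud -/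

/-- **EVERY DYADIC WINDOW HOLDS A LATTICE KNOB.** `0 < ε`, `0 < M`, `0 < ρhi`, `Mρhi² ≤ 2ε`
(`σ_hi M ≤ 2`) ⇒ some `k ∈ ℕ` with `1 ≤ k ≤ 2ε/(Mρhi²)` has `ρhi²/2 ≤ ε/(kM) ≤ ρhi²`
(`k = ⌈ε/(Mρhi²)⌉`). [folklore] -/
theorem exists_lattice_knob (hε : 0 < ε) (hM : 0 < M) {ρhi : ℝ} (hρhi : 0 < ρhi)
    (hwin : M * ρhi ^ 2 ≤ 2 * ε) :
    ∃ k : ℕ, 1 ≤ k ∧ (k : ℝ) ≤ 2 * ε / (M * ρhi ^ 2) ∧ ρhi ^ 2 / 2 ≤ ε / (k * M) ∧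
      ε / (k * M) ≤ ρhi ^ 2 := by
  have hden : 0 < M * ρhi ^ 2 := by positivity
  have hx : 1 / 2 ≤ ε / (M * ρhi ^ 2) := by
    rw [le_div_iff₀ hden]; linarith
  have hx0 : 0 < ε / (M * ρhi ^ 2) := by positivity
  refine ⟨⌈ε / (M * ρhi ^ 2)⌉₊, Nat.one_le_ceil_iff.2 hx0, ?_, ?_, ?_⟩
  · have h2 : 2 * ε / (M * ρhi ^ 2) = 2 * (ε / (M * ρhi ^ 2)) := by ring
    rw [h2]
    by_cases h1 : 1 ≤ ε / (M * ρhi ^ 2)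
    · linarith [Nat.ceil_lt_add_one hx0.le]
    · have hle : ⌈ε / (M * ρhi ^ 2)⌉₊ ≤ 1 := Nat.ceil_le.2 (by push_cast; linarith)
      have : (⌈ε / (M * ρhi ^ 2)⌉₊ : ℝ) ≤ 1 := by exact_mod_cast hle
      linarith
  · have hk0 : (0 : ℝ) < ⌈ε / (M * ρhi ^ 2)⌉₊ := by exact_mod_cast Nat.one_le_ceil_iff.2 hx0
    rw [le_div_iff₀ (by positivity)]
    have hk2 : (⌈ε / (M * ρhi ^ 2)⌉₊ : ℝ) ≤ 2 * (ε / (M * ρhi ^ 2)) := by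
      by_cases h1 : 1 ≤ ε / (M * ρhi ^ 2)
      · linarith [Nat.ceil_lt_add_one hx0.le]
      · have hle : ⌈ε / (M * ρhi ^ 2)⌉₊ ≤ 1 := Nat.ceil_le.2 (by push_cast; linarith)
        have : (⌈ε / (M * ρhi ^ 2)⌉₊ : ℝ) ≤ 1 := by exact_mod_cast hle
        linarith
    have h3 := mul_le_mul_of_nonneg_right hk2 hden.le
    have h4 : 2 * (ε / (M * ρhi ^ 2)) * (M * ρhi ^ 2) = 2 * ε := by field_simp
    nlinarith [h3, h4]
  · have hk0 : (0 : ℝ) < ⌈ε / (M * ρhi ^ 2)⌉₊ := by exact_mod_cast Nat.one_le_ceil_iff.2 hx0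
    rw [div_le_iff₀ (by positivity)]
    have h1 := Nat.le_ceil (ε / (M * ρhi ^ 2))
    have h3 := mul_le_mul_of_nonneg_right h1 hden.le
    have h4 : ε / (M * ρhi ^ 2) * (M * ρhi ^ 2) = ε := by field_simp
    nlinarith [h3, h4]

/-- **EVERY DYADIC WINDOW BELOW `σ_knob M = 2` CONTAINS A DUD.** Let `ρ ↦ X ρ` be exact
trajectories of `rotorCircuit K M ε ρ` from (5.6) with catalyst primitives `C ρ`, for the knobs
of the window `ρhi²/2 ≤ ρ² ≤ ρhi²` (`ρhi² ≤ ε ≤ 1`, `Mρhi² ≤ 2ε`), and suppose UNIFORMLY on the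
window, at common times `0 ≤ s₀ ≤ T`: armed entry (`b(s₀) ≥ b₁ > 0`, `c(s₀) ≤ γ₁`), pre-entry
dose `|Φ₀| ≤ φ₀`, `ã(s₀) ≤ θ₀`; catalyst alive and clock radius `≥ ϱ` on `[s₀,T]` (`Mϱ² > ε²`);
dead exit (`b(T) ≤ -β < 0`, `c(T) ≤ λ₀ρ²`, `λ₀ ≥ 0`), `ã(T) ≤ θ_T`. If
`ψ ≥ (2ε/(Mρhi²))·ζ_hi + φ₀` and `D ≥ 4(ε + ρhi²e^{-M} + Kθ₀)s₀ + 2(ε + ρhi²e^{-M} + Kθ_T)(T-s₀)`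
with `1 - ψ²/2 - D ≥ 0`, then SOME member of the window has
`ã(t)² ≤ 1 - (1 - ψ²/2 - D)² + 4ε(λ₀+ε)/(Mβ) + 4e^{-M}/M` for all `t ∈ [0, T + β/(2ε)]`.
[cite: Tao2016AveragedNS, §5.5 Theorem 5.3, (5.5), (5.6), (b-eq), (energy-con)] -/
theorem knob_window_dud {K M ε : ℝ} {X : ℝ → ℝ → Fin 5 → ℝ} {C : ℝ → ℝ → ℝ} (hε : 0 < ε)
    (hε1 : ε ≤ 1) (hM : 0 < M) (hK : 0 ≤ K) {ρhi : ℝ} (hρhi : 0 < ρhi) (hhiε : ρhi ^ 2 ≤ ε)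
    (hwin : M * ρhi ^ 2 ≤ 2 * ε) {s₀ T ϱ β b₁ γ₁ lam₀ φ₀ θ₀ θT ψ D : ℝ} (hs₀ : 0 ≤ s₀)
    (hsT : s₀ ≤ T) (hϱ : 0 < ϱ) (hq : ε ^ 2 < M * ϱ ^ 2) (hb₁ : 0 < b₁) (hβ : 0 < β)
    (hlam : 0 ≤ lam₀)
    (H : ∀ ρ, 0 < ρ → ρhi ^ 2 / 2 ≤ ρ ^ 2 → ρ ^ 2 ≤ ρhi ^ 2 →
      (∀ t, HasDerivAt (X ρ) (RotorKnob.rotorCircuit K M ε ρ (X ρ t)) t) ∧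
      X ρ 0 = delayInit ∧ (∀ t, HasDerivAt (C ρ) (X ρ t 2) t) ∧
      (∀ t ∈ Icc s₀ T, 0 < X ρ t 2) ∧ (∀ t ∈ Icc s₀ T, ϱ ^ 2 ≤ X ρ t 1 ^ 2 + X ρ t 2 ^ 2) ∧
      b₁ ≤ X ρ s₀ 1 ∧ X ρ s₀ 2 ≤ γ₁ ∧ X ρ T 1 ≤ -β ∧ X ρ T 2 ≤ lam₀ * ρ ^ 2 ∧
      |(C ρ s₀ - C ρ 0) / ρ ^ 2| ≤ φ₀ ∧ X ρ s₀ 4 ≤ θ₀ ∧ X ρ T 4 ≤ θT)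
    (hψ : 2 * ε / (M * ρhi ^ 2) * (arctan (γ₁ / b₁) + arctan (lam₀ * ρhi ^ 2 / β)
      + (π * (ε ^ 2 / (M * ϱ ^ 2)) + ρhi ^ 2 * exp (-M) * (T - s₀) / ϱ)
        / (1 - ε ^ 2 / (M * ϱ ^ 2))) + φ₀ ≤ ψ)
    (hD : 4 * ((ε + ρhi ^ 2 * exp (-M) + K * θ₀) * s₀)
      + 2 * ((ε + ρhi ^ 2 * exp (-M) + K * θT) * (T - s₀)) ≤ D) (hm : 0 ≤ 1 - ψ ^ 2 / 2 - D) :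
    ∃ ρ, 0 < ρ ∧ ρhi ^ 2 / 2 ≤ ρ ^ 2 ∧ ρ ^ 2 ≤ ρhi ^ 2 ∧ ∀ t ∈ Icc 0 (T + β / (2 * ε)),
      X ρ t 4 ^ 2 ≤ 1 - (1 - ψ ^ 2 / 2 - D) ^ 2
        + (4 * ε * (lam₀ + ε) / (M * β) + 4 * exp (-M) / M) := by
  obtain ⟨k, hk1, hk2, hlo, hhi⟩ := exists_lattice_knob hε hM hρhi hwin
  have hk0 : (0 : ℝ) < k := by exact_mod_cast hk1
  have hρ2 : Real.sqrt (ε / (k * M)) ^ 2 = ε / (k * M) := sq_sqrt (by positivity)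
  have hρ : 0 < Real.sqrt (ε / (k * M)) := sqrt_pos.2 (by positivity)
  have hkε : ε = k * M * Real.sqrt (ε / (k * M)) ^ 2 := by rw [hρ2]; field_simp
  rw [← hρ2] at hlo hhi
  obtain ⟨hX, h0, hC, hc, hr, hbs, hcγ, hbT, hcl, hΦ₀, hθ₀, hθT⟩ := H _ hρ hlo hhi
  refine ⟨Real.sqrt (ε / (k * M)), hρ, hlo, hhi, fun t ht => ?_⟩
  refine knob_lattice_dud hX h0 hε hε1 hρ (hhi.trans hhiε) hM hK hC k hkε hs₀ hsT hϱ hq hc hr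
    hb₁ hbs hcγ hβ hbT hcl hΦ₀ ?_ ?_ hm ht
  · -- the phase loss is monotone in the member: `k ≤ 2ε/(Mρhi²)`, `ρ² ≤ ρhi²`
    have h1q : 0 < 1 - ε ^ 2 / (M * ϱ ^ 2) := sub_pos.2 ((div_lt_one (by positivity)).2 hq)
    have hTs : 0 ≤ T - s₀ := by linarith
    have hγ₁ : 0 < γ₁ := (hc s₀ ⟨le_rfl, hsT⟩).trans_le hcγ
    have hat : arctan (lam₀ * Real.sqrt (ε / (k * M)) ^ 2 / β) ≤ arctan (lam₀ * ρhi ^ 2 / β) :=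
      arctan_mono (div_le_div_of_nonneg_right (mul_le_mul_of_nonneg_left hhi hlam) hβ.le)
    have hD0 : Real.sqrt (ε / (k * M)) ^ 2 * exp (-M) * (T - s₀) / ϱ
        ≤ ρhi ^ 2 * exp (-M) * (T - s₀) / ϱ :=
      div_le_div_of_nonneg_right (mul_le_mul_of_nonneg_right
        (mul_le_mul_of_nonneg_right hhi (exp_pos _).le) hTs) hϱ.le
    have hfr : (π * (ε ^ 2 / (M * ϱ ^ 2)) + Real.sqrt (ε / (k * M)) ^ 2 * exp (-M) * (T - s₀) / ϱ)
        / (1 - ε ^ 2 / (M * ϱ ^ 2)) ≤ (π * (ε ^ 2 / (M * ϱ ^ 2))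
          + ρhi ^ 2 * exp (-M) * (T - s₀) / ϱ) / (1 - ε ^ 2 / (M * ϱ ^ 2)) :=
      div_le_div_of_nonneg_right (by linarith) h1q.le
    have hζ0 : 0 ≤ arctan (γ₁ / b₁) + arctan (lam₀ * ρhi ^ 2 / β)
        + (π * (ε ^ 2 / (M * ϱ ^ 2)) + ρhi ^ 2 * exp (-M) * (T - s₀) / ϱ)
          / (1 - ε ^ 2 / (M * ϱ ^ 2)) := by
      have h1 : 0 ≤ arctan (γ₁ / b₁) := arctan_nonneg.2 (by positivity)
      have h2 : 0 ≤ arctan (lam₀ * ρhi ^ 2 / β) := arctan_nonneg.2 (by positivity)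
      positivity
    have hkζ := mul_le_mul_of_nonneg_right hk2 hζ0
    have hζ := mul_le_mul_of_nonneg_left (show arctan (γ₁ / b₁)
        + arctan (lam₀ * Real.sqrt (ε / (k * M)) ^ 2 / β) + (π * (ε ^ 2 / (M * ϱ ^ 2))
        + Real.sqrt (ε / (k * M)) ^ 2 * exp (-M) * (T - s₀) / ϱ) / (1 - ε ^ 2 / (M * ϱ ^ 2))
      ≤ arctan (γ₁ / b₁) + arctan (lam₀ * ρhi ^ 2 / β) + (π * (ε ^ 2 / (M * ϱ ^ 2))
        + ρhi ^ 2 * exp (-M) * (T - s₀) / ϱ) / (1 - ε ^ 2 / (M * ϱ ^ 2)) by linarith) hk0.le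
    linarith
  · -- the drift is monotone in the member: `ρ² ≤ ρhi²`, `ã(s₀) ≤ θ₀`, `ã(T) ≤ θ_T`
    have hTs : 0 ≤ T - s₀ := by linarith
    have hρe : Real.sqrt (ε / (k * M)) ^ 2 * exp (-M) ≤ ρhi ^ 2 * exp (-M) :=
      mul_le_mul_of_nonneg_right hhi (exp_pos _).le
    have hθ₀' := mul_le_mul_of_nonneg_left hθ₀ hK
    have hθT' := mul_le_mul_of_nonneg_left hθT hK
    have h1 : (ε + Real.sqrt (ε / (k * M)) ^ 2 * exp (-M)
          + K * X (Real.sqrt (ε / (k * M))) s₀ 4) * s₀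
        ≤ (ε + ρhi ^ 2 * exp (-M) + K * θ₀) * s₀ :=
      mul_le_mul_of_nonneg_right (by linarith) hs₀
    have h2 : (ε + Real.sqrt (ε / (k * M)) ^ 2 * exp (-M)
          + K * X (Real.sqrt (ε / (k * M))) T 4) * (T - s₀)
        ≤ (ε + ρhi ^ 2 * exp (-M) + K * θT) * (T - s₀) :=
      mul_le_mul_of_nonneg_right (by linarith) hTs
    linarith

/-- **NO ROBUST FIRING ACROSS A DYADIC WINDOW BELOW `σ_knob M = 2`.** In the setting of
`knob_window_dud`, if EVERY member of the window fires to deficit `δ` at some time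
`≤ T + β/(2ε)` (`ã² ≥ 1 - δ`), then `δ ≥ (1 - ψ²/2 - D)² - 4ε(λ₀+ε)/(Mβ) - 4e^{-M}/M`: the
phase-selection necessity of S13″c. [cite: Tao2016AveragedNS, §5.5 Theorem 5.3, (5.5), (5.6)] -/
theorem knob_window_not_robust {K M ε : ℝ} {X : ℝ → ℝ → Fin 5 → ℝ} {C : ℝ → ℝ → ℝ}
    (hε : 0 < ε) (hε1 : ε ≤ 1) (hM : 0 < M) (hK : 0 ≤ K) {ρhi : ℝ} (hρhi : 0 < ρhi)
    (hhiε : ρhi ^ 2 ≤ ε) (hwin : M * ρhi ^ 2 ≤ 2 * ε)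
    {s₀ T ϱ β b₁ γ₁ lam₀ φ₀ θ₀ θT ψ D δ : ℝ} (hs₀ : 0 ≤ s₀) (hsT : s₀ ≤ T) (hϱ : 0 < ϱ)
    (hq : ε ^ 2 < M * ϱ ^ 2) (hb₁ : 0 < b₁) (hβ : 0 < β) (hlam : 0 ≤ lam₀)
    (H : ∀ ρ, 0 < ρ → ρhi ^ 2 / 2 ≤ ρ ^ 2 → ρ ^ 2 ≤ ρhi ^ 2 →
      (∀ t, HasDerivAt (X ρ) (RotorKnob.rotorCircuit K M ε ρ (X ρ t)) t) ∧
      X ρ 0 = delayInit ∧ (∀ t, HasDerivAt (C ρ) (X ρ t 2) t) ∧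
      (∀ t ∈ Icc s₀ T, 0 < X ρ t 2) ∧ (∀ t ∈ Icc s₀ T, ϱ ^ 2 ≤ X ρ t 1 ^ 2 + X ρ t 2 ^ 2) ∧
      b₁ ≤ X ρ s₀ 1 ∧ X ρ s₀ 2 ≤ γ₁ ∧ X ρ T 1 ≤ -β ∧ X ρ T 2 ≤ lam₀ * ρ ^ 2 ∧
      |(C ρ s₀ - C ρ 0) / ρ ^ 2| ≤ φ₀ ∧ X ρ s₀ 4 ≤ θ₀ ∧ X ρ T 4 ≤ θT)
    (hψ : 2 * ε / (M * ρhi ^ 2) * (arctan (γ₁ / b₁) + arctan (lam₀ * ρhi ^ 2 / β)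
      + (π * (ε ^ 2 / (M * ϱ ^ 2)) + ρhi ^ 2 * exp (-M) * (T - s₀) / ϱ)
        / (1 - ε ^ 2 / (M * ϱ ^ 2))) + φ₀ ≤ ψ)
    (hD : 4 * ((ε + ρhi ^ 2 * exp (-M) + K * θ₀) * s₀)
      + 2 * ((ε + ρhi ^ 2 * exp (-M) + K * θT) * (T - s₀)) ≤ D) (hm : 0 ≤ 1 - ψ ^ 2 / 2 - D)
    (hfire : ∀ ρ, 0 < ρ → ρhi ^ 2 / 2 ≤ ρ ^ 2 → ρ ^ 2 ≤ ρhi ^ 2 →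
      ∃ t ∈ Icc 0 (T + β / (2 * ε)), 1 - δ ≤ X ρ t 4 ^ 2) :
    (1 - ψ ^ 2 / 2 - D) ^ 2 - (4 * ε * (lam₀ + ε) / (M * β) + 4 * exp (-M) / M) ≤ δ := by
  obtain ⟨ρ, hρ, hlo, hhi, hdud⟩ := knob_window_dud hε hε1 hM hK hρhi hhiε hwin hs₀ hsT hϱ hq
    hb₁ hβ hlam H hψ hD hm
  obtain ⟨t, ht, hf⟩ := hfire ρ hρ hlo hhi
  linarith [hdud t ht]

end Summit.NavierStokesRegularity.FluidComputer.GateBudget
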